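import Summits.QuantumFields.BalabanUV.Beta.GAN24.ForceSourceBounds

/-!
# `BalabanUV.Beta.GAN24.ForceSourceFeedback` — binder row G-an2-4 / (CONV-C), road P1-fibre, leaf **P1-L09** `FibreUniformBound`, part H1 (a), file 2/2
# (and the analytic content of part H3): the CAPACITANCE FEEDBACK `(φ, c)` OF THE UNIT FORCE SOURCE `f̂ = fhatF N M p l y′` is `O(N^{−(D+1)})`, N-uniformly

NOT IN PRINT; OUR PROOF ATTEMPT.  HONEST FRAMING (cell contract, verbatim): «discharging `BetaPertH` makes Bałaban's UV stability UNCONDITIONAL — a real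
constructive-QFT result; it is NOT the continuum limit and NOT the Clay problem.»  HONEST DEPENDENCY (verbatim): «continuum YM on T⁴ ⇐ BetaPertH ∧ nine spine
estimates (0/9 proved); BetaPertH ⇐ (D1) ∧ (D4) ∧ CAP+tail; G-an2-4 gates asym, D1 and NE2/3/4.»  [folklore] bookkeeping: leaf-20's endpoint bounds
`CapacitanceEndpoint.norm_phiSol_le/norm_cSol_le` (row P1-L08, BY NAME) fed with file 1/2 `ForceSourceBounds`; no new estimate idea, no cited fact, no wall binder,
no `def … : Prop`; two explicit-constant `def`s (`bPhi0`, `bC0`).  NOT summit progress; nothing of (CONV-C)'s K-slot `GAN24.CombesThomas.ConvCK 3 Lc` is discharged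
here; 0 wall binders instantiated; NOT `BetaPertH`, NOT continuum, NOT Clay.

## What is proved (`D N M : ℕ`, `0 < M ≤ N`, `q ∈ [−π, π]^D ∖ {0}`, `p = ofRealVec q`, `f̂ = fhatF N M p l y′`, `ĉ = 0`; `r = N/M`, `μ = |q|² = momSq q`, `C = aliasWtConst D`)
**`norm_phiSol_fhatF_le`**: `‖phiSol N p f̂ 0 κ‖ ≤ bPhi0 D r μ / N^{D+1}`;  **`norm_cSol_fhatF_le`**: `‖cSol N p f̂ 0‖ ≤ bC0 D r μ / N^{D+1}`, with the explicit constants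
`bPhi0 D r μ = cPP D·D(π²/4 + μ r^{D+1} C) + cPc D·(π³/8 + μ√μ r^{D+1} C/2)`, `bC0 D r μ = √μ·(cPc D·D(π²/4 + μ r^{D+1} C) + ccc D·(π³/8 + μ√μ r^{D+1} C/2))`, both
MONOTONE in `μ` (`bPhi0_mono`, `bC0_mono`), whence the q-free forms on the whole punctured zone (`μ ≤ Dπ²`): `norm_phiSol_fhatF_le'`, `norm_cSol_fhatF_le'`.
Power count (diagnostic; consumers do it by name): `× s_f(j)s_m(j) = M^{D+1}` gives H3 (`ScaledMF`) with `K₃ = bPhi0 D Lc (Dπ²)/Lc^{D+1}`; inside H1's `α(m)` the factor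
`N^{−(D+1)}` is what makes the φ-feed and gauge-column alias sums N-free.  Unit `b2b-balaban-gan24-formalise-leaf-03` (leaf prover 03, gen 6), 2026-08-20.
-/

noncomputable section

open Complex Finset
open scoped BigOperators Real

namespace Summit.QuantumFields.BalabanUV.Beta.GAN24.ForceSourceFeedback

open Literature.Probability.LatticeModels (TorusSite)
open Literature.MathematicalPhysics.QuantumFieldTheory.Balaban1983to89.B4Strip (ofRealVec)
open Literature.MathematicalPhysics.QuantumFieldTheory.King1986 (momSq momSq_nonneg momSq_le_card_mul_pi_sq)
open AliasWeightsSum (aliasWtConst)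
open AliasObjects (srcPhi srcC phiSol cSol fhatF)
open CapacitanceScalarBounds (momSq_pos)
open CapacitanceEndpointBlocks (cPP cPc ccc cPP_pos cPc_pos ccc_pos aliasWtConst_nonneg)
open CapacitanceEndpoint (norm_phiSol_le norm_cSol_le)
open ForceSourceBounds (momSq_mul_sum_norm_srcPhi_le momSq32_mul_norm_srcC_le)

variable {D N : ℕ} [NeZero N]


/-- The explicit `φ`-feedback constant `bPhi0 D r μ = cPP D·D(π²/4 + μ r^{D+1} C) + cPc D·(π³/8 + μ√μ r^{D+1} C/2)` (`r = N/M`, `μ = |q|²`, `C = aliasWtConst D`). -/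
def bPhi0 (D : ℕ) (r μ : ℝ) : ℝ :=
  cPP D * (D * (π ^ 2 / 4 + μ * r ^ (D + 1) * aliasWtConst D)) + cPc D * (π ^ 3 / 8 + μ * Real.sqrt μ * r ^ (D + 1) * aliasWtConst D / 2)

/-- The explicit `c`-feedback constant `bC0 D r μ = √μ·(cPc D·D(π²/4 + μ r^{D+1} C) + ccc D·(π³/8 + μ√μ r^{D+1} C/2))`. -/
def bC0 (D : ℕ) (r μ : ℝ) : ℝ :=
  Real.sqrt μ * (cPc D * (D * (π ^ 2 / 4 + μ * r ^ (D + 1) * aliasWtConst D)) + ccc D * (π ^ 3 / 8 + μ * Real.sqrt μ * r ^ (D + 1) * aliasWtConst D / 2))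

/-- [folklore] `0 ≤ bPhi0 D r μ` for `0 ≤ r`, `0 ≤ μ`. -/
theorem bPhi0_nonneg (D : ℕ) {r μ : ℝ} (hr : 0 ≤ r) (hμ : 0 ≤ μ) : 0 ≤ bPhi0 D r μ := by
  have := aliasWtConst_nonneg D
  have := (cPP_pos D).le
  have := (cPc_pos D).le
  unfold bPhi0
  positivity

/-- [folklore] `0 ≤ bC0 D r μ` for `0 ≤ r`, `0 ≤ μ`. -/
theorem bC0_nonneg (D : ℕ) {r μ : ℝ} (hr : 0 ≤ r) (hμ : 0 ≤ μ) : 0 ≤ bC0 D r μ := by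
  have := aliasWtConst_nonneg D
  have := (cPc_pos D).le
  have := (ccc_pos D).le
  unfold bC0
  positivity

/-- [folklore] `bPhi0` is monotone in `μ ≥ 0` (for `r ≥ 0`). -/
theorem bPhi0_mono (D : ℕ) {r μ μ' : ℝ} (hr : 0 ≤ r) (hμ : 0 ≤ μ) (h : μ ≤ μ') : bPhi0 D r μ ≤ bPhi0 D r μ' := by
  have hC := aliasWtConst_nonneg D
  have h1 := (cPP_pos D).le
  have h2 := (cPc_pos D).le
  have hs : Real.sqrt μ ≤ Real.sqrt μ' := Real.sqrt_le_sqrt h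
  have hμ' : 0 ≤ μ' := hμ.trans h
  unfold bPhi0
  gcongr

/-- [folklore] `bC0` is monotone in `μ ≥ 0` (for `r ≥ 0`). -/
theorem bC0_mono (D : ℕ) {r μ μ' : ℝ} (hr : 0 ≤ r) (hμ : 0 ≤ μ) (h : μ ≤ μ') : bC0 D r μ ≤ bC0 D r μ' := by
  have hC := aliasWtConst_nonneg D
  have h1 := (cPc_pos D).le
  have h2 := (ccc_pos D).le
  have hs : Real.sqrt μ ≤ Real.sqrt μ' := Real.sqrt_le_sqrt h
  have hμ' : 0 ≤ μ' := hμ.trans h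
  unfold bC0
  gcongr

section Feedback

variable {M : ℕ} (hN : 1 ≤ N) (hM : 0 < M) (hMN : M ≤ N) {q : Fin D → ℝ} (hq : ∀ i, |q i| ≤ π) (hq0 : q ≠ 0)
include hN hM hMN hq hq0

omit [NeZero N] hN hM hMN hq hq0 in
/-- [folklore] `N^{D+4} = N^{D+1}·N³`. -/
theorem pow_D4_eq : (N : ℝ) ^ (D + 4) = (N : ℝ) ^ (D + 1) * (N : ℝ) ^ 3 := by rw [← pow_add]

/-- [folklore] **THE CONSTRAINT MULTIPLIERS OF THE FORCE SOURCE**: `‖phiSol N p f̂ 0 κ‖ ≤ bPhi0 D (N/M) |q|² / N^{D+1}` for every `D`, `0 < M ≤ N`,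
`q ∈ [−π, π]^D ∖ {0}` (leaf-20's `norm_phiSol_le` fed with §2). -/
theorem norm_phiSol_fhatF_le (l : Fin D) (y' : Fin D → ℤ) (κ : Fin D) :
    ‖phiSol N (ofRealVec q) (fhatF N M (ofRealVec q) l y') 0 κ‖ ≤ bPhi0 D ((N : ℝ) / M) (momSq q) / (N : ℝ) ^ (D + 1) := by
  have hμ : 0 < momSq q := momSq_pos hq0
  have hsμ : 0 < Real.sqrt (momSq q) := Real.sqrt_pos.2 hμ
  have hNr : (0 : ℝ) < N := by exact_mod_cast hN
  have hP := momSq_mul_sum_norm_srcPhi_le hN hM hMN hq hq0 l y'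
  have hC := momSq32_mul_norm_srcC_le hN hM hMN hq hq0 l y'
  have h := norm_phiSol_le hN hq hq0 (fhatF N M (ofRealVec q) l y') 0 κ
  refine h.trans ?_
  -- rewrite both terms so that §2 applies verbatim
  have e1 : cPP D * momSq q / (N : ℝ) ^ (D + 4) * ∑ l', ‖srcPhi N (ofRealVec q) (fhatF N M (ofRealVec q) l y') 0 l'‖
      = cPP D / (N : ℝ) ^ (D + 4) * (momSq q * ∑ l', ‖srcPhi N (ofRealVec q) (fhatF N M (ofRealVec q) l y') 0 l'‖) := by ring
  have e2 : cPc D * (momSq q * Real.sqrt (momSq q)) / (N : ℝ) ^ (D + 4) * ‖srcC N (ofRealVec q) (fhatF N M (ofRealVec q) l y')‖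
      = cPc D / (N : ℝ) ^ (D + 4) * (momSq q * Real.sqrt (momSq q) * ‖srcC N (ofRealVec q) (fhatF N M (ofRealVec q) l y')‖) := by ring
  rw [e1, e2]
  calc cPP D / (N : ℝ) ^ (D + 4) * (momSq q * ∑ l', ‖srcPhi N (ofRealVec q) (fhatF N M (ofRealVec q) l y') 0 l'‖)
        + cPc D / (N : ℝ) ^ (D + 4) * (momSq q * Real.sqrt (momSq q) * ‖srcC N (ofRealVec q) (fhatF N M (ofRealVec q) l y')‖)
      ≤ cPP D / (N : ℝ) ^ (D + 4) * (D * ((N : ℝ) ^ 3 * (π ^ 2 / 4 + momSq q * ((N : ℝ) / M) ^ (D + 1) * aliasWtConst D)))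
        + cPc D / (N : ℝ) ^ (D + 4) * ((N : ℝ) ^ 3 * (π ^ 3 / 8 + momSq q * Real.sqrt (momSq q) * ((N : ℝ) / M) ^ (D + 1) * aliasWtConst D / 2)) :=
        add_le_add (mul_le_mul_of_nonneg_left hP (div_nonneg (cPP_pos D).le (by positivity)))
          (mul_le_mul_of_nonneg_left hC (div_nonneg (cPc_pos D).le (by positivity)))
    _ = bPhi0 D ((N : ℝ) / M) (momSq q) / (N : ℝ) ^ (D + 1) := by
        rw [pow_D4_eq (N := N) (D := D)]
        unfold bPhi0
        field_simp

/-- [folklore] **THE BLOCK GAUGE CONSTANT OF THE FORCE SOURCE**: `‖cSol N p f̂ 0‖ ≤ bC0 D (N/M) |q|² / N^{D+1}` (leaf-20's `norm_cSol_le` fed with §2;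
`|q|²√|q|² = √|q|²·|q|²`, `|q|⁴ = √|q|²·|q|²√|q|²`). -/
theorem norm_cSol_fhatF_le (l : Fin D) (y' : Fin D → ℤ) :
    ‖cSol N (ofRealVec q) (fhatF N M (ofRealVec q) l y') 0‖ ≤ bC0 D ((N : ℝ) / M) (momSq q) / (N : ℝ) ^ (D + 1) := by
  have hμ : 0 < momSq q := momSq_pos hq0
  have hsμ : 0 < Real.sqrt (momSq q) := Real.sqrt_pos.2 hμ
  have hNr : (0 : ℝ) < N := by exact_mod_cast hN
  have hP := momSq_mul_sum_norm_srcPhi_le hN hM hMN hq hq0 l y'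
  have hC := momSq32_mul_norm_srcC_le hN hM hMN hq hq0 l y'
  have h := norm_cSol_le hN hq hq0 (fhatF N M (ofRealVec q) l y') 0
  refine h.trans ?_
  have hsq : Real.sqrt (momSq q) * Real.sqrt (momSq q) = momSq q := Real.mul_self_sqrt hμ.le
  have e1 : cPc D * (momSq q * Real.sqrt (momSq q)) / (N : ℝ) ^ (D + 4) * ∑ l', ‖srcPhi N (ofRealVec q) (fhatF N M (ofRealVec q) l y') 0 l'‖
      = cPc D * Real.sqrt (momSq q) / (N : ℝ) ^ (D + 4) * (momSq q * ∑ l', ‖srcPhi N (ofRealVec q) (fhatF N M (ofRealVec q) l y') 0 l'‖) := by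
    ring
  have e2 : ccc D * momSq q ^ 2 / (N : ℝ) ^ (D + 4) * ‖srcC N (ofRealVec q) (fhatF N M (ofRealVec q) l y')‖
      = ccc D * Real.sqrt (momSq q) / (N : ℝ) ^ (D + 4) * (momSq q * Real.sqrt (momSq q) * ‖srcC N (ofRealVec q) (fhatF N M (ofRealVec q) l y')‖) := by
    calc ccc D * momSq q ^ 2 / (N : ℝ) ^ (D + 4) * ‖srcC N (ofRealVec q) (fhatF N M (ofRealVec q) l y')‖
        = ccc D * (Real.sqrt (momSq q) * Real.sqrt (momSq q)) * momSq q / (N : ℝ) ^ (D + 4) *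
            ‖srcC N (ofRealVec q) (fhatF N M (ofRealVec q) l y')‖ := by rw [hsq]; ring
      _ = _ := by ring
  rw [e1, e2]
  calc cPc D * Real.sqrt (momSq q) / (N : ℝ) ^ (D + 4) * (momSq q * ∑ l', ‖srcPhi N (ofRealVec q) (fhatF N M (ofRealVec q) l y') 0 l'‖)
        + ccc D * Real.sqrt (momSq q) / (N : ℝ) ^ (D + 4) *
          (momSq q * Real.sqrt (momSq q) * ‖srcC N (ofRealVec q) (fhatF N M (ofRealVec q) l y')‖)
      ≤ cPc D * Real.sqrt (momSq q) / (N : ℝ) ^ (D + 4) * (D * ((N : ℝ) ^ 3 * (π ^ 2 / 4 + momSq q * ((N : ℝ) / M) ^ (D + 1) * aliasWtConst D)))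
        + ccc D * Real.sqrt (momSq q) / (N : ℝ) ^ (D + 4) *
          ((N : ℝ) ^ 3 * (π ^ 3 / 8 + momSq q * Real.sqrt (momSq q) * ((N : ℝ) / M) ^ (D + 1) * aliasWtConst D / 2)) :=
        add_le_add (mul_le_mul_of_nonneg_left hP (div_nonneg (mul_nonneg (cPc_pos D).le hsμ.le) (by positivity)))
          (mul_le_mul_of_nonneg_left hC (div_nonneg (mul_nonneg (ccc_pos D).le hsμ.le) (by positivity)))
    _ = bC0 D ((N : ℝ) / M) (momSq q) / (N : ℝ) ^ (D + 1) := by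
        rw [pow_D4_eq (N := N) (D := D)]
        unfold bC0
        field_simp

/-- [folklore] q-FREE FORM: `‖phiSol N p f̂ 0 κ‖ ≤ bPhi0 D (N/M) (Dπ²) / N^{D+1}` on the whole punctured zone (`|q|² ≤ Dπ²`, `bPhi0_mono`). -/
theorem norm_phiSol_fhatF_le' (l : Fin D) (y' : Fin D → ℤ) (κ : Fin D) :
    ‖phiSol N (ofRealVec q) (fhatF N M (ofRealVec q) l y') 0 κ‖ ≤ bPhi0 D ((N : ℝ) / M) (D * π ^ 2) / (N : ℝ) ^ (D + 1) :=
  (norm_phiSol_fhatF_le hN hM hMN hq hq0 l y' κ).trans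
    (div_le_div_of_nonneg_right (bPhi0_mono D (by positivity) (momSq_nonneg q) (momSq_le_card_mul_pi_sq hq)) (by positivity))

/-- [folklore] q-FREE FORM: `‖cSol N p f̂ 0‖ ≤ bC0 D (N/M) (Dπ²) / N^{D+1}`. -/
theorem norm_cSol_fhatF_le' (l : Fin D) (y' : Fin D → ℤ) :
    ‖cSol N (ofRealVec q) (fhatF N M (ofRealVec q) l y') 0‖ ≤ bC0 D ((N : ℝ) / M) (D * π ^ 2) / (N : ℝ) ^ (D + 1) :=
  (norm_cSol_fhatF_le hN hM hMN hq hq0 l y').trans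
    (div_le_div_of_nonneg_right (bC0_mono D (by positivity) (momSq_nonneg q) (momSq_le_card_mul_pi_sq hq)) (by positivity))

end Feedback

end Summit.QuantumFields.BalabanUV.Beta.GAN24.ForceSourceFeedback

end
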